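import Literature.AlgebraicGeometry.HodgeTheory.IsogenyCategoryWeightOneHodgeEquivalence
import Literature.Geometry.Kaehler.ComplexTorusHomologyHodgeStructureHomomorphisms
import Literature.Geometry.Kaehler.ComplexTorusDualHodgeStructure
import Literature.Geometry.Kaehler.ComplexTorusDual
import Literature.Geometry.Kaehler.ComplexTorusDualAbelianVariety
import HarnessLib

/-!
# `H¹(f) = ρ_r(f̂)`: the cohomology functor of the isogeny category is the rational representation of
# the DUAL homomorphism — the dual-torus functor and the junction with the `H₁`-dictionary

Layer `Literature/AlgebraicGeometry/HodgeTheory`, namespace `Literature.AlgebraicGeometry.HodgeTheory.TorusIsogenyCat`;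
lane `lit-hodgefound` (Track 2 foundations library, Layer A1/A2), prover seat `lit-hodgefound-p35` (gen 6).
Junction file between
* Q390 `IsogenyCategoryWeightOneHodgeEquivalence.lean` (this seat): the functor
  `H1 : TorusIsogenyCatᵒᵖ ⥤ HodgeStructureCat 1`, `X ↦ H¹(X, ℚ) = rationalForms X.Φ 1`, `f ↦ f^*`
  (`pullbackHomRat`), fully faithful by Q278's `homEquivHomRat`;
* Q347 `Geometry/Kaehler/ComplexTorusHomologyHodgeStructureHomomorphisms.lean` (p15): the
  `H₁`-DICTIONARY — for a `ℚ`-space `V` with basis `b₀` and a complex structure `J` on `V_ℝ` compatible with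
  `J_Φ` (`hΦ`), the rational representation `ratRep b₀ b₀′ B = Matrix.toLin b₀ b₀′ B` and the bijection
  `ratRepHomEquiv : Hom_ℚ(X, X′) ≃ Hom (hodgeStructureOfCx J) (hodgeStructureOfCx J′)`;
* Q233-series `Geometry/Kaehler/ComplexTorusDualHodgeStructure.lean`: the lattice basis `(dxₐ)` =
  `coordOneFormBasis Φ` of `H¹(X, ℚ)`, the complex structure `dualHodgeJ Φ` (`= J_Φ̂`, `dualHodgeJ_compatible`)
  and **`hodgeStructureOfCx_dualHodgeJ : hodgeStructureOfCx (dualHodgeJ Φ) _ = hodgeStructure Φ 1`**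
  (`H₁(X̂, ℚ) = H¹(X, ℚ)` as Hodge structures).

The printed sentence being formalised (Lange, §1.1.3 Lemma 1.1.17 and §1.4.1 / §2.4; Birkenhake–Lange
§2.4 "the dual homomorphism"): in the basis `(dxₐ)` of `H¹(X, ℚ) = Hom(Λ, ℚ)` the matrix of `f^*` is the
TRANSPOSE `ᵗρ_r(f)` of the rational representation, i.e. `f^* = ρ_r(f̂)` is the rational representation
of the dual homomorphism `f̂ : Ŷ → X̂` in the dual lattice bases; so the functor `H¹` of Theorem 6.20 IS
the `H₁`-dictionary of Q347 applied to the dual tori, and `X ↦ X̂`, `f ↦ f̂ = ᵗf` is a contravariant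
endofunctor of the isogeny category.

Sources. H. Lange, *Abelian Varieties over the Complex Numbers* (2023) [held
`book:lange1992-complex-abelian-varieties`], §1.1.2 p. 19–20 (`ρ_a`, `ρ_r`), §1.1.3 Lemma 1.1.17
(`H¹(X, ℤ) = Hom(Λ, ℤ)`; induced maps), §1.4.1 (the dual torus `X̂ = Ω̄/Λ̂`, the dual homomorphism
`f̂`, "`^` is a contravariant functor", `ρ_a(f̂) = ᵗρ̄_a(f)`); C. Voisin, *Hodge Theory I* §7.2.2 (PDF
pp. 141–142: "the Hodge structure on `H¹(T)` is dual to that of `H¹(X)`"); P. Deligne, J. S. Milne,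
LNM 900 II §6 Thm. 6.20 (the functor `H¹_B`).

## Contents (theorems and definitions with bodies; NO named fact)

* §1 MATRICES: `coordOneFormBasis_repr` (`(dx)-coordinates = periods`),
  **`toMatrix_coordOneFormBasis_pullbackFormsRat`** (`[B^*]_{dx′, dx} = ᵗB` for every rational `B`),
  **`H1_map_toLinearMap_eq_toLin_transpose`** (`H¹(f) = toLin (dx_Y) (dx_X) ᵗf`).
* §2 THE DUAL HOMOMORPHISM AND THE DUAL-TORUS FUNCTOR: `jMatrix_dualPeriod'` (private copy of
  `J_Φ̂ = -ᵗJ_Φ`), **`transpose_mem_homRat_dualPeriod`** (`B ∈ Hom_ℚ(X, Y) ⟹ ᵗB ∈ Hom_ℚ(Ŷ, X̂)`),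
  `dualObj X` (`X̂` as an object), **`dualFunctor : TorusIsogenyCatᵒᵖ ⥤ TorusIsogenyCat`** (`X ↦ X̂`,
  `f ↦ f̂ = ᵗf`), `dualFunctor_map_val`, `dualFunctor.Additive`, `dualFunctor.Faithful`.
* §3 THE JUNCTION WITH THE `H₁`-DICTIONARY: **`H1_obj_str_eq_hodgeStructureOfCx`**
  (`(H¹ X).str = hodgeStructureOfCx (dualHodgeJ X.Φ)` — `H¹(X) = H₁(X̂)`),
  **`H1_map_toLinearMap_eq_ratRep`** (`H¹(f) = ratRep (dx_Y) (dx_X) ᵗf`) and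
  **`H1_map_toLinearMap_eq_ratRepHomEquiv`**: the underlying linear map of `H1.map f.op` is that of Q347's
  `ratRepHomEquiv` for the DUAL tori `Ŷ`, `X̂` (bases `dx`, complex structures `dualHodgeJ`, compatibility
  `dualHodgeJ_compatible`) applied to `f̂ = ᵗf`.
* §5 (placed before §4) DUALITY: `jMatrix_dualPeriod_dualPeriod` (`J_{X̂̂} = J_X`),
  `homRat_dualPeriod_dualPeriod`, `one_mem_homRat_dualPeriod_dualPeriod(')`, **`doubleDualIso X : X ≅ X̂̂`**,
  **`doubleDualNatIso : 𝟭 ≅ (^)ᵒᵖ ⋙ (^)`**, `dualFunctor.Full` / `EssSurj` / **`IsEquivalence`**,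
  **`dualEquivalence : TorusIsogenyCatᵒᵖ ≌ TorusIsogenyCat`** (the isogeny category is self-dual),
  `isAbelianVariety_dualObj_iff`, **`dualFunctorIsab : Isabᵒᵖ ⥤ Isab`** (the dual abelian variety; Full,
  Faithful, EssSurj, IsEquivalence), **`dualEquivalenceIsab : Isabᵒᵖ ≌ Isab`**.
* §4 VALIDATION: `toMatrix_H1_map_id` (`[H¹(1_X)] = 1`), `toMatrix_H1_map_comp` (contravariance on
  matrices), `card_dualObj_ι` / `card_dualObj_elliptic` (`rk Λ̂ = rk Λ`; the dual of an elliptic curve).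

## References

* [Lange2023AbelianVarietiesComplex] H. Lange, *Abelian Varieties over the Complex Numbers*, Grundlehren
  Text Edition, Springer (2023), §1.1.2 (pp. 19–20), §1.1.3 Lemma 1.1.17, §1.4.1.
* [LangeBirkenhake1992] H. Lange, Ch. Birkenhake, *Complex Abelian Varieties* (Springer 1992), §2.4
  (the dual complex torus, the dual homomorphism).
* [VoisinHodgeI2002] C. Voisin, *Hodge Theory and Complex Algebraic Geometry I* (CUP 2002), §7.2.2.
* [DeligneMilne1982Tannakian] P. Deligne, J. S. Milne, *Tannakian Categories*, LNM 900 (1982), II §6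
  Thm. 6.20 (p. 212).
* [Lang1982AbelianFunctions] S. Lang, *Introduction to Algebraic and Abelian Functions*, 2nd ed., GTM 89
  (Springer 1982), Ch. VII §5.
* [MumfordAV1970] D. Mumford, *Abelian Varieties* (1970), §13 (the dual abelian variety).
* [vanGeemen1994HodgeAV] B. van Geemen, *An introduction to the Hodge conjecture for abelian varieties*,
  LNM 1594 (1994), 3.6.
-/

noncomputable section

-- Nested instance problems on the carriers `↥(rationalForms Φ 1)` (a `ℚ`-subspace of a `ℂ`-space of
-- `ℝ`-multilinear maps), cf. `Geometry/Kaehler/ComplexTorusFirstCohomologyDuality.lean`.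
set_option maxSynthPendingDepth 3

open CategoryTheory Opposite
open Module
open scoped Matrix

namespace Literature.AlgebraicGeometry.HodgeTheory

open Literature.AlgebraicGeometry.Motives Literature.AlgebraicGeometry.Motives.HodgeStructure
open Literature.Geometry.Kaehler Literature.Geometry.Kaehler.ComplexTorus

/-! ## §1 The matrix of `f^*` on `H¹` in the lattice bases `(dx)` is the transpose `ᵗρ_r(f)` -/

section Matrices

variable {ι ι' : Type} [Fintype ι] [Fintype ι'] [DecidableEq ι] [DecidableEq ι']
  {E E' : Type} [NormedAddCommGroup E] [NormedSpace ℂ E] [NormedAddCommGroup E'] [NormedSpace ℂ E']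
  (Φ : (ι → ℝ) ≃L[ℝ] E) (Φ' : (ι' → ℝ) ≃L[ℝ] E')

/-- **The `(dxₐ)`-coordinates of a class `γ ∈ H¹(X, ℚ)` are its periods `γ(λₐ)`** (`H¹(X, ℤ) = Hom(Λ, ℤ)`:
`γ = Σₐ γ(λₐ) dxₐ`, `eq_sum_oneFormPeriod_smul_coordOneForm`). [cite: Lange2023AbelianVarietiesComplex, §1.1.3 Lemma 1.1.17] -/
theorem coordOneFormBasis_repr (γ : rationalForms Φ 1) (a : ι) :
    (coordOneFormBasis Φ).repr γ a = oneFormPeriod Φ γ a := by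
  conv_lhs => rw [eq_sum_oneFormPeriod_smul_coordOneForm Φ γ]
  simp_rw [← coordOneFormBasis_apply]
  rw [Basis.repr_sum_self]

/-- **`[B^*] = ᵗB`**: in the lattice bases `(dx′_{a′})` of `H¹(X′, ℚ)` and `(dxₐ)` of `H¹(X, ℚ)` the matrix of
the pull-back `B^* = pullbackFormsRat Φ Φ′ B 1 : H¹(X′, ℚ) → H¹(X, ℚ)` of a rational matrix
`B ∈ Hom(Λ, Λ′) ⊗ ℚ` is the TRANSPOSE of `B` (`B^* dx′_{a′} = Σₐ B_{a′a} dxₐ`; Q278's `homMatrix_pullbackFormsRat`).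
[cite: Lange2023AbelianVarietiesComplex, §1.1.3 Lemma 1.1.17 and §1.1.2 p. 20] -/
theorem toMatrix_coordOneFormBasis_pullbackFormsRat (B : Matrix ι' ι ℚ) :
    LinearMap.toMatrix (coordOneFormBasis Φ') (coordOneFormBasis Φ) (pullbackFormsRat Φ Φ' B 1) = Bᵀ := by
  ext a a'
  rw [LinearMap.toMatrix_apply, coordOneFormBasis_repr, coordOneFormBasis_apply, ← homMatrix_apply,
    homMatrix_pullbackFormsRat, Matrix.transpose_apply]

/-- `B^* = Matrix.toLin (dx′) (dx) ᵗB` on `H¹`. [cite: Lange2023AbelianVarietiesComplex, §1.1.3 Lemma 1.1.17] -/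
theorem pullbackFormsRat_one_eq_toLin_transpose (B : Matrix ι' ι ℚ) :
    pullbackFormsRat Φ Φ' B 1 = Matrix.toLin (coordOneFormBasis Φ') (coordOneFormBasis Φ) Bᵀ := by
  rw [← toMatrix_coordOneFormBasis_pullbackFormsRat Φ Φ' B, Matrix.toLin_toMatrix]

end Matrices

namespace TorusIsogenyCat

/-- **`H¹(f) = toLin (dx_Y) (dx_X) ᵗρ_r(f)`**: the functor `H1` of Theorem 6.20 sends `f : X → Y` (rational
representation `ρ_r(f) ∈ M(ι_Y × ι_X, ℚ)`) to the linear map `H¹(Y, ℚ) → H¹(X, ℚ)` with matrix `ᵗρ_r(f)`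
in the lattice bases. [cite: Lange2023AbelianVarietiesComplex, §1.1.3 Lemma 1.1.17 and §1.1.2 p. 20]
[cite: DeligneMilne1982Tannakian, II §6 Thm. 6.20, p. 212] -/
theorem H1_map_toLinearMap_eq_toLin_transpose {X Y : TorusIsogenyCat} (f : X ⟶ Y) :
    (H1.map f.op).toLinearMap =
      Matrix.toLin (coordOneFormBasis Y.Φ) (coordOneFormBasis X.Φ) f.1ᵀ := by
  rw [H1_map_toLinearMap]
  exact pullbackFormsRat_one_eq_toLin_transpose X.Φ Y.Φ f.1

/-- The matrix of `H¹(f)` in the lattice bases is `ᵗρ_r(f)`. [cite: Lange2023AbelianVarietiesComplex, §1.1.3 Lemma 1.1.17] -/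
theorem toMatrix_H1_map {X Y : TorusIsogenyCat} (f : X ⟶ Y) :
    LinearMap.toMatrix (coordOneFormBasis Y.Φ) (coordOneFormBasis X.Φ) (H1.map f.op).toLinearMap = f.1ᵀ := by
  rw [H1_map_toLinearMap]
  exact toMatrix_coordOneFormBasis_pullbackFormsRat X.Φ Y.Φ f.1

end TorusIsogenyCat

/-! ## §2 The dual homomorphism `f̂ = ᵗf` and the dual-torus functor `X ↦ X̂` -/

section DualHom

variable {ι ι' : Type*} [Fintype ι] [Fintype ι'] [DecidableEq ι] [DecidableEq ι']
  {E E' : Type*} [NormedAddCommGroup E] [NormedSpace ℂ E] [NormedAddCommGroup E'] [NormedSpace ℂ E']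
  (Φ : (ι → ℝ) ≃L[ℝ] E) (Φ' : (ι' → ℝ) ≃L[ℝ] E')

/-- `J_{Φ̂} = -ᵗJ_Φ` in matrix form (a private copy, to keep the import closure small, of
`jMatrix_dualPeriod` of `ComplexTorusHodgeGroupFunctoriality.lean`; from `latticeJ_dualPeriod_dotProduct`).
[cite: Lange2023AbelianVarietiesComplex, §1.4.1] -/
private theorem jMatrix_dualPeriod' : jMatrix (dualPeriod Φ) = -(jMatrix Φ)ᵀ := by
  refine Matrix.ext fun i j ↦ ?_
  have h := latticeJ_dualPeriod_dotProduct Φ (Pi.single j 1) (Pi.single i 1)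
  rw [← jMatrix_mulVec, ← jMatrix_mulVec] at h
  simpa [Matrix.mulVec, dotProduct, Pi.single_apply, Matrix.transpose_apply] using h

/-- **The dual homomorphism: `B ∈ Hom_ℚ(X, X′) ⟹ ᵗB ∈ Hom_ℚ(X̂′, X̂)`** (`ρ_r(f̂) = ᵗρ_r(f)` in the dual
lattice bases: transpose `B J_Φ = J_{Φ′} B` and use `J_Φ̂ = -ᵗJ_Φ`). [cite: Lange2023AbelianVarietiesComplex, §1.4.1]
[cite: LangeBirkenhake1992, §2.4] -/
theorem transpose_mem_homRat_dualPeriod {B : Matrix ι' ι ℚ} (hB : B ∈ homRat Φ Φ') :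
    Bᵀ ∈ homRat (dualPeriod Φ') (dualPeriod Φ) := by
  rw [mem_homRat_iff] at hB ⊢
  rw [jMatrix_dualPeriod', jMatrix_dualPeriod', Matrix.transpose_map, Matrix.mul_neg, Matrix.neg_mul,
    ← Matrix.transpose_mul, ← Matrix.transpose_mul, hB]

end DualHom

namespace TorusIsogenyCat

/-- **The dual torus `X̂ = Ω̄/Λ̂` as an object of the isogeny category** (period isomorphism `dualPeriod X.Φ`
onto the antidual `Ω̄ = Hom_ℂ̄(E, ℂ)`, dual lattice basis indexed by the same `ι`).
[cite: Lange2023AbelianVarietiesComplex, §1.4.1] [cite: LangeBirkenhake1992, §2.4] -/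
abbrev dualObj (X : TorusIsogenyCat) : TorusIsogenyCat :=
  haveI : FiniteDimensional ℝ (X.E →L⋆[ℂ] ℂ) :=
    LinearEquiv.finiteDimensional (dualPeriod X.Φ).toLinearEquiv
  haveI : FiniteDimensional ℂ (X.E →L⋆[ℂ] ℂ) := Module.Finite.of_restrictScalars_finite ℝ ℂ _
  of (dualPeriod X.Φ)

/-- The index type of `X̂` is that of `X`. [cite: Lange2023AbelianVarietiesComplex, §1.4.1] -/
@[simp] theorem dualObj_ι (X : TorusIsogenyCat) : (dualObj X).ι = X.ι := rfl

/-- The period isomorphism of `X̂` is `dualPeriod X.Φ`. [cite: Lange2023AbelianVarietiesComplex, §1.4.1] -/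
@[simp] theorem dualObj_Φ (X : TorusIsogenyCat) : (dualObj X).Φ = dualPeriod X.Φ := rfl

/-- **THE DUAL-TORUS FUNCTOR `X ↦ X̂`, `f ↦ f̂`** on the isogeny category (contravariant; the rational
representation of `f̂` in the dual lattice bases is `ᵗρ_r(f)`; "`^` is a contravariant functor":
`(g f)^ = f̂ ĝ`, `(1_X)^ = 1_{X̂}`). [cite: Lange2023AbelianVarietiesComplex, §1.4.1] [cite: LangeBirkenhake1992, §2.4] -/
def dualFunctor : TorusIsogenyCatᵒᵖ ⥤ TorusIsogenyCat where
  obj X := dualObj X.unop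
  map {X Y} f := ⟨f.unop.1ᵀ, transpose_mem_homRat_dualPeriod Y.unop.Φ X.unop.Φ f.unop.2⟩
  map_id X := hom_ext (by
    change (𝟙 X.unop : X.unop ⟶ X.unop).1ᵀ = 1
    rw [id_val, Matrix.transpose_one])
  map_comp {X Y Z} f g := hom_ext (by
    change ((f ≫ g).unop).1ᵀ = (g.unop).1ᵀ * (f.unop).1ᵀ
    rw [unop_comp, comp_val, Matrix.transpose_mul])

/-- The matrix of `f̂` is `ᵗρ_r(f)`. [cite: Lange2023AbelianVarietiesComplex, §1.4.1] -/
@[simp] theorem dualFunctor_map_val {X Y : TorusIsogenyCatᵒᵖ} (f : X ⟶ Y) :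
    (dualFunctor.map f).1 = f.unop.1ᵀ := rfl

/-- `dualFunctor.obj (op X) = X̂`. [cite: Lange2023AbelianVarietiesComplex, §1.4.1] -/
theorem dualFunctor_obj (X : TorusIsogenyCat) : dualFunctor.obj (op X) = dualObj X := rfl

/-- The dual-torus functor is additive (`(f + g)^ = f̂ + ĝ`). [cite: LangeBirkenhake1992, §2.4] -/
instance : dualFunctor.Additive where
  map_add {X Y f g} := hom_ext (by
    rw [dualFunctor_map_val, add_val, dualFunctor_map_val, dualFunctor_map_val, unop_add, add_val]
    exact Matrix.transpose_add _ _)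

/-- The dual-torus functor is faithful (`ᵗB` determines `B`). [cite: LangeBirkenhake1992, §2.4] -/
instance : dualFunctor.Faithful where
  map_injective h :=
    Quiver.Hom.unop_inj (hom_ext (Matrix.transpose_injective (congrArg (fun k ↦ k.1) h)))

/-! ## §3 The junction: `H¹` is the `H₁`-dictionary of the dual tori -/

/-- **`H¹(X, ℚ) = H₁(X̂, ℚ)` as Hodge structures, in functor language**: the Hodge structure of the object
`H1.obj (op X)` of Hod_ℚ is Q347/A1-20's `hodgeStructureOfCx` of the complex structure `J_{X̂} = dualHodgeJ X.Φ`
on `H¹(X, ℝ) = Λ̂ ⊗ ℝ` (`hodgeStructureOfCx_dualHodgeJ`). [cite: VoisinHodgeI2002, §7.2.2 (PDF pp. 141–142)]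
[cite: Lange2023AbelianVarietiesComplex, §1.4.1] -/
theorem H1_obj_str_eq_hodgeStructureOfCx (X : TorusIsogenyCat) :
    (H1.obj (op X)).str = hodgeStructureOfCx (dualHodgeJ X.Φ) (dualHodgeJ_dualHodgeJ X.Φ) :=
  (hodgeStructureOfCx_dualHodgeJ X.Φ).symm

/-- **`H¹(f) = ρ_r(ᵗf)`** read with Q347's rational representation `ratRep` on the `ℚ`-spaces
`H¹(Y, ℚ)`, `H¹(X, ℚ)` with their lattice bases `(dx)`. [cite: Lange2023AbelianVarietiesComplex, §1.1.2 p. 19 and §1.4.1] -/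
theorem H1_map_toLinearMap_eq_ratRep {X Y : TorusIsogenyCat} (f : X ⟶ Y) :
    (H1.map f.op).toLinearMap = ratRep (coordOneFormBasis Y.Φ) (coordOneFormBasis X.Φ) f.1ᵀ := by
  rw [ratRep_eq_toLin]
  exact H1_map_toLinearMap_eq_toLin_transpose f

/-- **THE JUNCTION OF THEOREM 6.20's FUNCTOR `H¹` WITH THE `H₁`-DICTIONARY (Q347 `ratRepHomEquiv`)**: for
`f : X → Y` in the isogeny category, the morphism of Hodge structures `H¹(f) : H¹(Y, ℚ) → H¹(X, ℚ)` has the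
same underlying linear map as the image of the DUAL homomorphism `f̂ = ᵗf ∈ Hom_ℚ(Ŷ, X̂)` under p15's
bijection `ratRepHomEquiv : Hom_ℚ(Ŷ, X̂) ≃ Hom (H₁(Ŷ), H₁(X̂))` — taken for the dual tori
`Ŷ = dualPeriod Y.Φ`, `X̂ = dualPeriod X.Φ`, the lattice bases `(dx)` = `coordOneFormBasis`, the complex
structures `dualHodgeJ` and their compatibilities `dualHodgeJ_compatible` (so that `H₁(X̂) = H¹(X)` by
`hodgeStructureOfCx_dualHodgeJ`). [cite: DeligneMilne1982Tannakian, II §6 Thm. 6.20, p. 212]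
[cite: Lange2023AbelianVarietiesComplex, §1.4.1 and §7.2.2 Prop. 7.2.5 (proof)] [cite: vanGeemen1994HodgeAV, 3.6] -/
theorem H1_map_toLinearMap_eq_ratRepHomEquiv {X Y : TorusIsogenyCat} (f : X ⟶ Y) :
    (H1.map f.op).toLinearMap =
      (ratRepHomEquiv (coordOneFormBasis Y.Φ) (coordOneFormBasis X.Φ) (dualPeriod Y.Φ) (dualPeriod X.Φ)
        (dualHodgeJ Y.Φ) (dualHodgeJ X.Φ) (dualHodgeJ_compatible Y.Φ) (dualHodgeJ_compatible X.Φ)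
        (dualHodgeJ_dualHodgeJ Y.Φ) (dualHodgeJ_dualHodgeJ X.Φ)
        ⟨f.1ᵀ, transpose_mem_homRat_dualPeriod X.Φ Y.Φ f.2⟩).toLinearMap := by
  rw [ratRepHomEquiv_apply_toLinearMap]
  exact H1_map_toLinearMap_eq_ratRep f

/-- The same junction phrased with the dual-torus functor: `H¹(f)` is `ρ_r` of `dualFunctor.map f.op`.
[cite: Lange2023AbelianVarietiesComplex, §1.4.1] -/
theorem H1_map_toLinearMap_eq_ratRep_dualFunctor {X Y : TorusIsogenyCat} (f : X ⟶ Y) :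
    (H1.map f.op).toLinearMap =
      ratRep (coordOneFormBasis Y.Φ) (coordOneFormBasis X.Φ) (dualFunctor.map f.op).1 := by
  rw [dualFunctor_map_val]
  exact H1_map_toLinearMap_eq_ratRep f

end TorusIsogenyCat

/-! ## §5 Duality: `X ↦ X̂` is an anti-equivalence — the isogeny category is equivalent to its opposite -/

section DoubleDual

variable {ι ι' : Type*} [Fintype ι] [Fintype ι'] [DecidableEq ι] [DecidableEq ι']
  {E E' : Type*} [NormedAddCommGroup E] [NormedSpace ℂ E] [NormedAddCommGroup E'] [NormedSpace ℂ E']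
  (Φ : (ι → ℝ) ≃L[ℝ] E) (Φ' : (ι' → ℝ) ≃L[ℝ] E')

/-- `J_{X̂̂} = J_X` in the (double dual = original) lattice basis. [cite: Lange2023AbelianVarietiesComplex, §1.4.1] -/
theorem _root_.Literature.Geometry.Kaehler.ComplexTorus.jMatrix_dualPeriod_dualPeriod :
    jMatrix (dualPeriod (dualPeriod Φ)) = jMatrix Φ := by
  rw [jMatrix_dualPeriod', jMatrix_dualPeriod', Matrix.transpose_neg, Matrix.transpose_transpose, neg_neg]

/-- **`Hom_ℚ(X̂̂, Ŷ̂) = Hom_ℚ(X, Y)`** as spaces of rational matrices (the complex structures of `X̂̂` and `X`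
agree in the lattice bases). [cite: Lange2023AbelianVarietiesComplex, §1.4.1] -/
theorem _root_.Literature.Geometry.Kaehler.ComplexTorus.homRat_dualPeriod_dualPeriod :
    homRat (dualPeriod (dualPeriod Φ)) (dualPeriod (dualPeriod Φ')) = homRat Φ Φ' := by
  refine SetLike.ext fun B ↦ ?_
  rw [mem_homRat_iff, mem_homRat_iff, jMatrix_dualPeriod_dualPeriod, jMatrix_dualPeriod_dualPeriod]

/-- **The identity matrix is a homomorphism `X → X̂̂`** (the canonical isomorphism `X ≅ X̂̂` has rational
representation `1` in the lattice basis and its double dual). [cite: Lange2023AbelianVarietiesComplex, §1.4.1] -/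
theorem _root_.Literature.Geometry.Kaehler.ComplexTorus.one_mem_homRat_dualPeriod_dualPeriod :
    (1 : Matrix ι ι ℚ) ∈ homRat Φ (dualPeriod (dualPeriod Φ)) := by
  rw [mem_homRat_iff, jMatrix_dualPeriod_dualPeriod, Matrix.map_one _ Rat.cast_zero Rat.cast_one,
    Matrix.one_mul, Matrix.mul_one]

/-- The identity matrix is a homomorphism `X̂̂ → X`. [cite: Lange2023AbelianVarietiesComplex, §1.4.1] -/
theorem _root_.Literature.Geometry.Kaehler.ComplexTorus.one_mem_homRat_dualPeriod_dualPeriod' :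
    (1 : Matrix ι ι ℚ) ∈ homRat (dualPeriod (dualPeriod Φ)) Φ := by
  rw [mem_homRat_iff, jMatrix_dualPeriod_dualPeriod, Matrix.map_one _ Rat.cast_zero Rat.cast_one,
    Matrix.one_mul, Matrix.mul_one]

end DoubleDual

namespace TorusIsogenyCat

/-- **`X ≅ X̂̂` in the isogeny category** (the canonical isomorphism, matrix `1`; "`Λ` is the lattice in `V`
dual to `Λ̂`. So we get `X̂̂ = X`"). [cite: Lange2023AbelianVarietiesComplex, §1.4.1] [cite: LangeBirkenhake1992, §2.4] -/
def doubleDualIso (X : TorusIsogenyCat) : X ≅ dualObj (dualObj X) where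
  hom := ⟨1, one_mem_homRat_dualPeriod_dualPeriod X.Φ⟩
  inv := ⟨1, one_mem_homRat_dualPeriod_dualPeriod' X.Φ⟩
  hom_inv_id := hom_ext (by rw [comp_val, id_val]; exact Matrix.mul_one _)
  inv_hom_id := hom_ext (by rw [comp_val, id_val]; exact Matrix.mul_one _)

/-- The matrix of `X ≅ X̂̂` is `1`. [cite: Lange2023AbelianVarietiesComplex, §1.4.1] -/
@[simp] theorem doubleDualIso_hom_val (X : TorusIsogenyCat) : (doubleDualIso X).hom.1 = 1 := rfl

/-- The matrix of `X̂̂ ≅ X` is `1`. [cite: Lange2023AbelianVarietiesComplex, §1.4.1] -/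
@[simp] theorem doubleDualIso_inv_val (X : TorusIsogenyCat) : (doubleDualIso X).inv.1 = 1 := rfl

/-- **`X ↦ X̂̂` is naturally isomorphic to the identity**: `𝟭 ≅ (^)ᵒᵖ ⋙ (^)` (the squares commute since
`ᵗᵗf = f`). [cite: LangeBirkenhake1992, §2.4] -/
def doubleDualNatIso : 𝟭 TorusIsogenyCat ≅ dualFunctor.rightOp ⋙ dualFunctor :=
  NatIso.ofComponents (fun X ↦ doubleDualIso X) (fun {X Y} f ↦ hom_ext (by
    change (1 : Matrix Y.ι Y.ι ℚ) * f.1 = f.1ᵀᵀ * (1 : Matrix X.ι X.ι ℚ)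
    rw [Matrix.transpose_transpose, Matrix.one_mul, Matrix.mul_one]))

/-- The dual-torus functor is full (`g : X̂ → Ŷ` is `ᵗ(ᵗg)` with `ᵗg ∈ Hom_ℚ(Ŷ̂, X̂̂) = Hom_ℚ(Y, X)`).
[cite: LangeBirkenhake1992, §2.4] -/
instance : dualFunctor.Full where
  map_surjective {X Y} g :=
    ⟨Quiver.Hom.op (X := Y.unop) (Y := X.unop) ⟨g.1ᵀ, by
        have h : g.1ᵀ ∈ homRat (dualPeriod (dualPeriod Y.unop.Φ)) (dualPeriod (dualPeriod X.unop.Φ)) :=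
          transpose_mem_homRat_dualPeriod _ _ g.2
        rwa [homRat_dualPeriod_dualPeriod] at h⟩,
      hom_ext (by rw [dualFunctor_map_val, Quiver.Hom.unop_op]; exact Matrix.transpose_transpose _)⟩

/-- The dual-torus functor is essentially surjective (`Y ≅ (Ŷ)^`). [cite: LangeBirkenhake1992, §2.4] -/
instance : dualFunctor.EssSurj where
  mem_essImage Y := ⟨op (dualObj Y), ⟨(doubleDualIso Y).symm⟩⟩

/-- **DUALITY: `X ↦ X̂` IS AN ANTI-EQUIVALENCE OF THE ISOGENY CATEGORY OF COMPLEX TORI WITH ITSELF**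
(full, faithful, essentially surjective). [cite: LangeBirkenhake1992, §2.4] [cite: Lange2023AbelianVarietiesComplex, §1.4.1] -/
instance : dualFunctor.IsEquivalence where

/-- The isogeny category of complex tori is equivalent to its opposite, by duality.
[cite: LangeBirkenhake1992, §2.4] -/
def dualEquivalence : TorusIsogenyCatᵒᵖ ≌ TorusIsogenyCat := dualFunctor.asEquivalence

/-- **The dual of an abelian variety is an abelian variety, and conversely** (`isAbelianVariety_dual_iff`):
Isab is stable under `X ↦ X̂`. [cite: Lange2023AbelianVarietiesComplex, §2.1.1 Prop. 2.1.1 and §2.4]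
[cite: Lang1982AbelianFunctions, Ch. VII §5 Thm. 5.2] -/
theorem isAbelianVariety_dualObj_iff (X : TorusIsogenyCat) :
    isAbelianVariety (dualObj X) ↔ isAbelianVariety X :=
  isAbelianVariety_dual_iff X.Φ

/-- **The dual abelian variety functor `Isabᵒᵖ ⥤ Isab`, `X ↦ X̂`.** [cite: Lange2023AbelianVarietiesComplex, §2.4 (the dual abelian variety)]
[cite: MumfordAV1970, §13] -/
def dualFunctorIsab : Isabᵒᵖ ⥤ Isab :=
  isAbelianVariety.lift (isAbelianVariety.ι.op ⋙ dualFunctor)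
    fun X ↦ (isAbelianVariety_dualObj_iff X.unop.obj).2 X.unop.property

/-- `dualFunctorIsab` on objects is `X ↦ X̂`. [cite: Lange2023AbelianVarietiesComplex, §2.4] -/
theorem dualFunctorIsab_obj_obj (X : Isabᵒᵖ) : (dualFunctorIsab.obj X).obj = dualObj X.unop.obj := rfl

/-- The dual abelian variety functor is full. [cite: Lange2023AbelianVarietiesComplex, §2.4] -/
instance : dualFunctorIsab.Full :=
  inferInstanceAs (isAbelianVariety.lift (isAbelianVariety.ι.op ⋙ dualFunctor)
    fun X ↦ (isAbelianVariety_dualObj_iff X.unop.obj).2 X.unop.property).Full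

/-- The dual abelian variety functor is faithful. [cite: Lange2023AbelianVarietiesComplex, §2.4] -/
instance : dualFunctorIsab.Faithful :=
  inferInstanceAs (isAbelianVariety.lift (isAbelianVariety.ι.op ⋙ dualFunctor)
    fun X ↦ (isAbelianVariety_dualObj_iff X.unop.obj).2 X.unop.property).Faithful

/-- The dual abelian variety functor is essentially surjective (`Y ≅ (Ŷ)^` with `Ŷ` an abelian variety).
[cite: Lange2023AbelianVarietiesComplex, §2.4] -/
instance : dualFunctorIsab.EssSurj where
  mem_essImage Y :=
    ⟨op ⟨dualObj Y.obj, (isAbelianVariety_dualObj_iff Y.obj).2 Y.property⟩,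
      ⟨isAbelianVariety.isoMk (doubleDualIso Y.obj).symm⟩⟩

/-- **DUALITY ON Isab_ℂ: `X ↦ X̂` is an anti-equivalence of the category of abelian varieties up to
isogeny with itself.** [cite: Lange2023AbelianVarietiesComplex, §2.4] [cite: MumfordAV1970, §13] -/
instance : dualFunctorIsab.IsEquivalence where

/-- Isab_ℂ is equivalent to its opposite, by duality. [cite: Lange2023AbelianVarietiesComplex, §2.4] -/
def dualEquivalenceIsab : Isabᵒᵖ ≌ Isab := dualFunctorIsab.asEquivalence

end TorusIsogenyCat

namespace TorusIsogenyCat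

/-! ## §4 Validation -/

/-- The matrix of `H¹(1_X)` in the lattice basis is `1`. [cite: Lange2023AbelianVarietiesComplex, §1.1.3 Lemma 1.1.17] -/
theorem toMatrix_H1_map_id (X : TorusIsogenyCat) :
    LinearMap.toMatrix (coordOneFormBasis X.Φ) (coordOneFormBasis X.Φ) (H1.map (𝟙 (op X))).toLinearMap = 1 := by
  rw [show (𝟙 (op X) : op X ⟶ op X) = (𝟙 X : X ⟶ X).op from rfl, toMatrix_H1_map, id_val,
    Matrix.transpose_one]

/-- The matrix of `H¹(g ∘ f)` is `ᵗρ_r(f) ᵗρ_r(g)` (contravariance read on matrices).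
[cite: Lange2023AbelianVarietiesComplex, §1.1.3 Lemma 1.1.17] -/
theorem toMatrix_H1_map_comp {X Y Z : TorusIsogenyCat} (f : X ⟶ Y) (g : Y ⟶ Z) :
    LinearMap.toMatrix (coordOneFormBasis Z.Φ) (coordOneFormBasis X.Φ) (H1.map (f ≫ g).op).toLinearMap =
      f.1ᵀ * g.1ᵀ := by
  rw [toMatrix_H1_map, comp_val, Matrix.transpose_mul]

/-- **Validation: `X̂` has the same lattice rank as `X`** (`rk Λ̂ = rk Λ`). [cite: Lange2023AbelianVarietiesComplex, §1.4.1] -/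
theorem card_dualObj_ι (X : TorusIsogenyCat) : Fintype.card (dualObj X).ι = Fintype.card X.ι := rfl

/-- **Validation: the dual of an elliptic curve `E_τ` is an object of the isogeny category with lattice rank
`2`.** [cite: Lange2023AbelianVarietiesComplex, §1.4.1 and §2.1.1 Example 2.1.3] -/
theorem card_dualObj_elliptic {τ : ℂ} (hτ : τ.im ≠ 0) :
    Fintype.card (dualObj (of (ellipticPeriod hτ))).ι = 2 :=
  (card_dualObj_ι _).trans (Fintype.card_fin 2)

end TorusIsogenyCat

end Literature.AlgebraicGeometry.HodgeTheory

end
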